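import Summits.CriticalPhenomena.PercolationContinuityZ3.Theorems.PercNearOneGluingNoHeavyLowerTailKNQuestion9ContractLaw
import Summits.CriticalPhenomena.PercolationContinuityZ3.Theorems.PercNearOneGluingNoHeavyLowerTailSahiTwoChainUnions
import Literature.Probability.Percolation.ShorteningInfluenceBound
import Literature.Combinatorics.Sahi2008.Percolation
import HarnessLib

/-!
# Series reduction: suppressing a degree-two vertex preserves every Sahi functional of principal cluster events

Support file for the Sahi programme (`--supports stmt-CriticalPhenomena-4575`, prover prim-sahi-p2 gen 10).  No definitions, no named facts,
no sorries; standard axioms.  Memo `…/prim-sahi-p2/PROOF-E3.md` §21.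

**Theorem `sahiE_principal_seriesReduce`.**  Let `w : Sym2 V → [0,1]` and let the vertex `x` have positive weight only towards `y` and `y'`
(`w s(x,z) = 0` for `z ∉ {y, y'}`, the loop included).  Let `w'` be a SERIES-REDUCED weight: `w' = 0` on the pairs at `x`, `w' = w` on every other
pair except `s(y,y')`, where `w' s(y,y') = 1 − (1 − w s(y,y'))·(1 − w s(x,y)·w s(x,y'))` (the pair `y—y'` in parallel with the two-edge path
`y—x—y'`).  Then for every root `s ≠ x` and every family of target sets avoiding `x`, the principal cluster events `{C_s ⊇ T_i}` have the SAME
joint moments (`real_principal_seriesReduce`) and hence the same `E_n` under `bernoulliWeight w` and `bernoulliWeight w'`.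
Consequently a minimal counterexample to Sahi positivity of principal cluster events has no vertex of weighted degree two outside the root
and the targets (parallel reduction is built into pair weights), and theorems on graphs with few vertices
(`SahiPrincipalAntichain.sahiE_principal_fin_four`, `…threeTargets_le_five`) apply to all their subdivisions with the targets kept.

**Proof.**  One-bond decomposition along `f = s(x,y')` (tree `prodBernoulli_real_oneBond`).  With `f` forced open, `x` is identified with
`y'` by the tree's contraction of a weight-one pair (`KnQ9Contract.real_eq_of_contract`, `reachable_contract_iff`): the contracted weight puts
`w s(x,y)` in parallel with `w s(y,y')`.  With `f` forced closed, `x` hangs on `y` alone: one more one-bond step along `s(x,y)` and the same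
contraction lemma (for the weight-one pair `s(y,x)`, whose contraction just deletes `x`: `cweight_eq_of_pendant`) show that `s(x,y)` is
irrelevant.  The two branches and `w'` are finally compared by a one-bond decomposition along `s(y,y')`, off which all three weights agree;
what remains is `(1−p')((1−a)P₀ + aP₁) + p'((1−a⊕b)P₀ + (a⊕b)P₁) = (1−q')P₀ + q'P₁` with `a⊕b = 1−(1−a)(1−b)`, `q' = 1−(1−a)(1−b p')`.
-/

noncomputable section

namespace Summit.CriticalPhenomena.PercolationContinuityZ3.Theorems

namespace SahiSeriesReduction

open Finset MeasureTheory Set unitInterval Literature.Combinatorics.Sahi2008 Literature.Probability.Percolation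
  Literature.Probability.LatticeModels KnQ9Contract
open Literature.Probability.Percolation.DecisionTree (ind ind_of_mem ind_of_not_mem ind_nonneg)
open scoped Classical

variable {V : Type*}

/-! ### Plumbing on pairs and weights -/

/-- A pair containing `x` is `s(x, z)` for some `z`. [folklore] -/
private theorem exists_eq_mk_of_mem {x : V} {e : Sym2 V} (h : x ∈ e) : ∃ z, e = s(x, z) := by
  induction e using Sym2.ind with
  | h a b =>
    rcases Sym2.mem_iff.1 h with rfl | rfl
    · exact ⟨b, rfl⟩
    · exact ⟨a, Sym2.eq_swap⟩

/-- **Contracting a pendant weight-one pair just deletes the pendant vertex**: if every pair at `u'` other than `s(u,u')` has weight `0`,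
the contracted weight is `W` off `u'` and `0` at `u'`. [folklore] -/
theorem cweight_eq_of_pendant {u u' : V} (huu' : u ≠ u') (W : Sym2 V → unitInterval)
    (hW : ∀ z, z ≠ u → z ≠ u' → W s(z, u') = 0) (e : Sym2 V) :
    cweight u u' W e = if u' ∈ e then 0 else W e := by
  induction e using Sym2.ind with
  | h a b =>
    by_cases h : u' ∈ s(a, b)
    · rw [if_pos h, cweight_of_mem W h]
    · rw [if_neg h]
      have ha : a ≠ u' := fun ha => h (ha ▸ Sym2.mem_mk_left a b)
      have hb : b ≠ u' := fun hb => h (hb ▸ Sym2.mem_mk_right a b)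
      by_cases hay : a = u ∧ b ≠ u
      · obtain ⟨rfl, hbu⟩ := hay
        rw [show s(a, b) = s(b, a) from Sym2.eq_swap]
        apply Subtype.ext
        rw [coe_cweight_parallel huu' W hbu hb, hW b hbu hb]
        push_cast
        ring
      · by_cases hby : b = u ∧ a ≠ u
        · obtain ⟨rfl, hau⟩ := hby
          apply Subtype.ext
          rw [coe_cweight_parallel huu' W hau ha, hW a hau ha]
          push_cast
          ring
        · exact cweight_of_not W ha hb hay hby

section Weights

variable (w : Sym2 V → unitInterval) {x y y' : V}

/-- The weight with the two pairs of `x` switched off vanishes at every pair of `x`. [folklore] -/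
private theorem w0_of_mem (hyy' : y ≠ y') (hw : ∀ z, z ≠ y → z ≠ y' → w s(x, z) = 0) {e : Sym2 V} (he : x ∈ e) :
    Function.update (Function.update w s(x, y') 0) s(x, y) 0 e = 0 := by
  obtain ⟨z, rfl⟩ := exists_eq_mk_of_mem he
  by_cases hzy : z = y
  · subst hzy; rw [Function.update_self]
  · have hne1 : s(x, z) ≠ s(x, y) := fun h => by
      rcases Sym2.eq_iff.1 h with ⟨_, h2⟩ | ⟨h1, h2⟩
      · exact hzy h2
      · exact hzy (h2.trans h1)
    rw [Function.update_of_ne hne1]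
    by_cases hzy' : z = y'
    · subst hzy'; rw [Function.update_self]
    · have hne2 : s(x, z) ≠ s(x, y') := fun h => by
        rcases Sym2.eq_iff.1 h with ⟨_, h2⟩ | ⟨h1, h2⟩
        · exact hzy' h2
        · exact hzy' (h2.trans h1)
      rw [Function.update_of_ne hne2]
      exact hw z hzy hzy'

/-- Off `x`, the weight with the two pairs of `x` switched off is `w`. [folklore] -/
private theorem w0_of_not_mem {e : Sym2 V} (he : x ∉ e) :
    Function.update (Function.update w s(x, y') 0) s(x, y) 0 e = w e := by
  have h1 : e ≠ s(x, y) := fun h => he (h ▸ Sym2.mem_mk_left x y)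
  have h2 : e ≠ s(x, y') := fun h => he (h ▸ Sym2.mem_mk_left x y')
  rw [Function.update_of_ne h1, Function.update_of_ne h2]

/-- **Closed branch.**  With `f = s(x,y')` switched off and `s(x,y)` switched on, contracting the weight-one pair `s(y,x)` yields the
weight with both pairs of `x` switched off. [folklore] -/
private theorem cweight_closed (hxy : x ≠ y) (hyy' : y ≠ y') (hw : ∀ z, z ≠ y → z ≠ y' → w s(x, z) = 0) :
    cweight y x (Function.update (Function.update w s(x, y') 0) s(x, y) 1) =
      Function.update (Function.update w s(x, y') 0) s(x, y) 0 := by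
  funext e
  rw [cweight_eq_of_pendant hxy.symm _ (fun z hzy hzx => ?_)]
  · by_cases he : x ∈ e
    · rw [if_pos he, w0_of_mem w hyy' hw he]
    · have h1 : e ≠ s(x, y) := fun h => he (h ▸ Sym2.mem_mk_left x y)
      have h2 : e ≠ s(x, y') := fun h => he (h ▸ Sym2.mem_mk_left x y')
      rw [if_neg he, w0_of_not_mem w he, Function.update_of_ne h1, Function.update_of_ne h2]
  · -- pairs `s(z, x)`, `z ≠ y`: weight 0
    have hne : s(z, x) ≠ s(x, y) := fun h => by
      rcases Sym2.eq_iff.1 h with ⟨h1, _⟩ | ⟨h1, _⟩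
      · exact hzx h1
      · exact hzy h1
    rw [Function.update_of_ne hne]
    by_cases hzy' : z = y'
    · subst hzy'
      rw [show s(z, x) = s(x, z) from Sym2.eq_swap, Function.update_self]
    · have hne' : s(z, x) ≠ s(x, y') := fun h => by
        rcases Sym2.eq_iff.1 h with ⟨h1, _⟩ | ⟨h1, _⟩
        · exact hzx h1
        · exact hzy' h1
      rw [Function.update_of_ne hne', Sym2.eq_swap]
      exact hw z hzy hzy'

/-- **Open branch.**  With `f = s(x,y')` switched on, the contracted weight along `s(y',x)`: `0` at `x`, `w` off `x` except at `s(y,y')`. [folklore] -/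
private theorem cweight_open_of_not_mem (hxy' : x ≠ y') (hw : ∀ z, z ≠ y → z ≠ y' → w s(x, z) = 0)
    {e : Sym2 V} (he : x ∉ e) (heg : e ≠ s(y, y')) :
    cweight y' x (Function.update w s(x, y') 1) e = w e := by
  revert he heg
  induction e using Sym2.ind with
  | h a b =>
    intro he heg
    have ha : a ≠ x := fun h => he (h ▸ Sym2.mem_mk_left a b)
    have hb : b ≠ x := fun h => he (h ▸ Sym2.mem_mk_right a b)
    have hupd : ∀ c d : V, c ≠ x → d ≠ x → Function.update w s(x, y') 1 s(c, d) = w s(c, d) := by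
      intro c d hc hd
      have hne : s(c, d) ≠ s(x, y') := fun h => by
        rcases Sym2.eq_iff.1 h with ⟨h1, _⟩ | ⟨_, h2⟩
        · exact hc h1
        · exact hd h2
      exact Function.update_of_ne hne _ _
    by_cases hay : a = y' ∧ b ≠ y'
    · obtain ⟨rfl, hby'⟩ := hay
      have hby : b ≠ y := fun h => heg (by rw [h, Sym2.eq_swap])
      rw [show s(a, b) = s(b, a) from Sym2.eq_swap]
      apply Subtype.ext
      have hne : s(b, x) ≠ s(x, a) := fun h => by
        rcases Sym2.eq_iff.1 h with ⟨h1, _⟩ | ⟨h1, _⟩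
        · exact hb h1
        · exact hby' h1
      rw [coe_cweight_parallel hxy'.symm _ hby' hb, hupd b a hb ha,
        Function.update_of_ne hne, show s(b, x) = s(x, b) from Sym2.eq_swap, hw b hby hby']
      push_cast; ring
    · by_cases hby : b = y' ∧ a ≠ y'
      · obtain ⟨rfl, hay'⟩ := hby
        have hay'' : a ≠ y := fun h => heg (by rw [h])
        apply Subtype.ext
        have hne : s(a, x) ≠ s(x, b) := fun h => by
          rcases Sym2.eq_iff.1 h with ⟨h1, _⟩ | ⟨h1, _⟩
          · exact ha h1
          · exact hay' h1
        rw [coe_cweight_parallel hxy'.symm _ hay' ha, hupd a b ha hb,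
          Function.update_of_ne hne, show s(a, x) = s(x, a) from Sym2.eq_swap, hw a hay'' hay']
        push_cast; ring
      · rw [cweight_of_not _ ha hb hay hby, hupd a b ha hb]

/-- The open-branch weight at `s(y,y')`: `w s(y,y') ⊕ w s(x,y)`. [folklore] -/
private theorem coe_cweight_open_yy' (hxy : x ≠ y) (hxy' : x ≠ y') (hyy' : y ≠ y') :
    (cweight y' x (Function.update w s(x, y') 1) s(y, y') : ℝ) = 1 - (1 - w s(y, y')) * (1 - w s(x, y)) := by
  have hne1 : s(y, y') ≠ s(x, y') := fun h => by
    rcases Sym2.eq_iff.1 h with ⟨h1, _⟩ | ⟨h1, _⟩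
    · exact hxy h1.symm
    · exact hyy' h1
  have hne2 : s(y, x) ≠ s(x, y') := fun h => by
    rcases Sym2.eq_iff.1 h with ⟨h1, _⟩ | ⟨h1, _⟩
    · exact hxy h1.symm
    · exact hyy' h1
  rw [coe_cweight_parallel hxy'.symm _ hyy' hxy.symm, Function.update_of_ne hne1, Function.update_of_ne hne2,
    show s(y, x) = s(x, y) from Sym2.eq_swap]

end Weights

/-! ### Probabilities -/

section Probabilities

variable [Fintype V]

/-- Every event is determined by the set of all pairs. [folklore] -/
private theorem determinedBy_univ' (A : Set (Set (Sym2 V))) :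
    DeterminedBy A (↑(Finset.univ : Finset (Sym2 V)) : Set (Sym2 V)) := by
  rw [determinedBy_iff]
  intro ω ω' h
  rw [Finset.coe_univ, Set.inter_univ, Set.inter_univ] at h
  rw [h]

/-- One-bond decomposition of any event along any pair (the tree's `prodBernoulli_real_oneBond`). [folklore] -/
private theorem oneBond (w : Sym2 V → unitInterval) (e : Sym2 V) (A : Set (Set (Sym2 V))) :
    (prodBernoulli w).real A = (1 - (w e : ℝ)) * (prodBernoulli (Function.update w e 0)).real A +
      (w e : ℝ) * (prodBernoulli (Function.update w e 1)).real A :=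
  prodBernoulli_real_oneBond (determinedBy_univ' A) w (Finset.mem_univ e)

omit [Fintype V] in
/-- The principal event `{C_s ⊇ U}` corresponds to itself under the contraction of the pair `s(u, x)` when `s` and `U` avoid `x`
(the identification `π` fixes `s` and `U`). [folklore] -/
private theorem principal_contract_iff {u x : V} (hux : u ≠ x) {s : V} (hs : s ≠ x) {U : Finset V} (hU : x ∉ U)
    (ω : Set (Sym2 V)) (hω : s(u, x) ∈ ω) :
    ω ∈ (⋂ t ∈ U, (openConn s t : Set (BondConfig V))) ↔
      contract u x ω ∈ (⋂ t ∈ U, (openConn s t : Set (BondConfig V))) := by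
  simp only [Set.mem_iInter]
  refine forall₂_congr fun t ht => ?_
  have hts : t ≠ x := fun h => hU (h ▸ ht)
  have key := reachable_contract_iff hux hω s t
  rw [proj, if_neg hs, proj, if_neg hts] at key
  exact key

/-- **Series reduction preserves the probability of every principal cluster event avoiding `x`.** [this work] -/
theorem real_principal_seriesReduce (w w' : Sym2 V → unitInterval) {x y y' s : V}
    (hxy : x ≠ y) (hxy' : x ≠ y') (hyy' : y ≠ y') (hsx : s ≠ x)
    (hw : ∀ z, z ≠ y → z ≠ y' → w s(x, z) = 0)
    (hw'x : ∀ z, w' s(x, z) = 0) (hw'e : ∀ e, x ∉ e → e ≠ s(y, y') → w' e = w e)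
    (hw'yy : (w' s(y, y') : ℝ) = 1 - (1 - w s(y, y')) * (1 - w s(x, y) * w s(x, y')))
    (U : Finset V) (hU : x ∉ U) :
    (prodBernoulli w).real (⋂ t ∈ U, (openConn s t : Set (BondConfig V))) =
      (prodBernoulli w').real (⋂ t ∈ U, (openConn s t : Set (BondConfig V))) := by
  set A : Set (BondConfig V) := ⋂ t ∈ U, (openConn s t : Set (BondConfig V)) with hA
  set w0 : Sym2 V → unitInterval := Function.update (Function.update w s(x, y') 0) s(x, y) 0 with hw0
  set w1 : Sym2 V → unitInterval := cweight y' x (Function.update w s(x, y') 1) with hw1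
  -- (b) open branch: contract the weight-one pair s(y', x)
  have hopen : (prodBernoulli (Function.update w s(x, y') 1)).real A = (prodBernoulli w1).real A := by
    refine real_eq_of_contract hxy'.symm _ ?_ A A fun ω hω => principal_contract_iff hxy'.symm hsx hU ω hω
    rw [show s(y', x) = s(x, y') from Sym2.eq_swap, Function.update_self]
  -- (c) closed branch: the pendant pair s(x, y) is irrelevant
  have hclosed : (prodBernoulli (Function.update w s(x, y') 0)).real A = (prodBernoulli w0).real A := by
    rw [oneBond (Function.update w s(x, y') 0) s(x, y) A]
    have h1 : (prodBernoulli (Function.update (Function.update w s(x, y') 0) s(x, y) 1)).real A =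
        (prodBernoulli w0).real A := by
      rw [real_eq_of_contract hxy.symm (Function.update (Function.update w s(x, y') 0) s(x, y) 1) ?_ A A
          fun ω hω => principal_contract_iff hxy.symm hsx hU ω hω, cweight_closed w hxy hyy' hw]
      rw [show s(y, x) = s(x, y) from Sym2.eq_swap, Function.update_self]
    rw [h1]
    ring
  -- (d) compare w0, w1, w' along g = s(y, y')
  have hW1 : ∀ c, Function.update w1 s(y, y') c = Function.update w0 s(y, y') c := by
    intro c
    funext e
    by_cases heg : e = s(y, y')
    · subst heg; rw [Function.update_self, Function.update_self]
    · rw [Function.update_of_ne heg, Function.update_of_ne heg]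
      by_cases hxe : x ∈ e
      · rw [hw1, cweight_of_mem _ hxe, hw0, w0_of_mem w hyy' hw hxe]
      · rw [hw1, cweight_open_of_not_mem w hxy' hw hxe heg, hw0, w0_of_not_mem w hxe]
  have hW' : ∀ c, Function.update w' s(y, y') c = Function.update w0 s(y, y') c := by
    intro c
    funext e
    by_cases heg : e = s(y, y')
    · subst heg; rw [Function.update_self, Function.update_self]
    · rw [Function.update_of_ne heg, Function.update_of_ne heg]
      by_cases hxe : x ∈ e
      · obtain ⟨z, rfl⟩ := exists_eq_mk_of_mem hxe
        rw [hw'x z, hw0, w0_of_mem w hyy' hw hxe]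
      · rw [hw'e e hxe heg, hw0, w0_of_not_mem w hxe]
  have e0 : (w0 s(y, y') : ℝ) = w s(y, y') := by
    rw [hw0, w0_of_not_mem w (fun h => ?_)]
    rcases Sym2.mem_iff.1 h with h | h
    · exact hxy h
    · exact hxy' h
  have e1 : (w1 s(y, y') : ℝ) = 1 - (1 - w s(y, y')) * (1 - w s(x, y)) := coe_cweight_open_yy' w hxy hxy' hyy'
  have ef0 : ((Function.update w s(x, y') 0 s(x, y) : unitInterval) : ℝ) = w s(x, y) := by
    rw [Function.update_of_ne (fun h => ?_)]
    rcases Sym2.eq_iff.1 h with ⟨_, h2⟩ | ⟨h1, _⟩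
    · exact hyy' h2
    · exact hxy' h1
  rw [oneBond w s(x, y') A, hopen, hclosed, oneBond w0 s(y, y') A, oneBond w1 s(y, y') A, oneBond w' s(y, y') A,
    hW1 0, hW1 1, hW' 0, hW' 1, e0, e1, hw'yy]
  ring

omit [Fintype V] in
/-- Products of indicators are indicators of intersections (plumbing). [folklore] -/
private theorem prod_ind_eq_ind_biInter {α ι : Type*} (S : Finset ι) (B : ι → Set α) :
    ∏ i ∈ S, ind (B i) = ind (⋂ i ∈ S, B i) := by
  classical
  induction S using Finset.induction_on with
  | empty => funext a; simp [ind_of_mem]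
  | insert a S ha ih =>
    rw [Finset.prod_insert ha, ih]
    funext z
    rw [Pi.mul_apply, ← BHK2006.ind_inter]
    congr 1
    ext z'
    simp

/-- **Series reduction preserves every Sahi functional of principal cluster events** (targets and root avoiding the suppressed vertex `x`).
Hence minimal counterexamples to Sahi positivity of principal cluster events have no vertex of weighted degree two outside the root and the
targets, and the small-graph theorems (`SahiPrincipalAntichain.sahiE_principal_fin_four`, `…threeTargets_le_five`) extend to every
subdivision with the targets kept. [this work] -/
theorem sahiE_principal_seriesReduce (w w' : Sym2 V → unitInterval) {x y y' s : V}
    (hxy : x ≠ y) (hxy' : x ≠ y') (hyy' : y ≠ y') (hsx : s ≠ x)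
    (hw : ∀ z, z ≠ y → z ≠ y' → w s(x, z) = 0)
    (hw'x : ∀ z, w' s(x, z) = 0) (hw'e : ∀ e, x ∉ e → e ≠ s(y, y') → w' e = w e)
    (hw'yy : (w' s(y, y') : ℝ) = 1 - (1 - w s(y, y')) * (1 - w s(x, y) * w s(x, y')))
    (n : ℕ) (T : Fin n → Finset V) (hT : ∀ i, x ∉ T i) :
    sahiE (bernoulliWeight w) n (fun i => ind (⋂ t ∈ T i, (openConn s t : Set (BondConfig V)))) =
      sahiE (bernoulliWeight w') n (fun i => ind (⋂ t ∈ T i, (openConn s t : Set (BondConfig V)))) := by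
  refine TwoChainUnions.sahiE_congr_of_prodMoments _ _ n _ _ fun S => ?_
  have hset : (⋂ i ∈ S, ⋂ t ∈ T i, (openConn s t : Set (BondConfig V))) =
      ⋂ t ∈ S.biUnion T, (openConn s t : Set (BondConfig V)) := by
    ext ω
    simp only [Set.mem_iInter, Finset.mem_biUnion]
    constructor
    · rintro h t ⟨i, hi, ht⟩
      exact h i hi t ht
    · intro h i hi t ht
      exact h t ⟨i, hi, ht⟩
  rw [prod_ind_eq_ind_biInter, ex_bernoulliWeight_ind, ex_bernoulliWeight_ind, hset]
  refine real_principal_seriesReduce w w' hxy hxy' hyy' hsx hw hw'x hw'e hw'yy (S.biUnion T) fun h => ?_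
  obtain ⟨i, -, hi⟩ := Finset.mem_biUnion.1 h
  exact hT i hi

end Probabilities

end SahiSeriesReduction

end Summit.CriticalPhenomena.PercolationContinuityZ3.Theorems
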